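import Summits.ValiantsHypothesis.ValiantsHypothesis.Theorems.FifoMatchingNCMatchings
import HarnessLib

/-!
# 231-avoiding bijections of a block (support for `FifoMatching.Av231InVP`, step 2)

Combinatorial half of route item `stmt-ValiantsHypothesis-11620`: a 231-avoiding bijection
`f : [p, p+m) → [v, v+m)` (identity outside the block, `IsAvOn p v m f`) splits at the position
`q = p + a` of its maximum `v + m - 1` into a 231-avoiding bijection `[p, q) → [v, v+a)` and one
`(q, p+m) → [v+a, v+m-1)` (231-freeness forces every value left of the maximum below every value
right of it; the value ranges follow by counting, `left_lt` / `right_ge`), the weight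
`∏ x_{x, f x}` factors accordingly (`awt_eq_mul`), and gluing (`aglue`) inverts the splitting.
[folklore: Knuth, one-stack-sortable = 231-avoiding, Catalan decomposition]
-/

noncomputable section

-- layout Summits/ValiantsHypothesis/ValiantsHypothesis forces the duplicated namespace component
set_option linter.dupNamespace false

namespace Summit.ValiantsHypothesis.ValiantsHypothesis.Theorems.FifoMatching

open MvPolynomial

universe u

variable {k : Type u} [CommSemiring k] {N : ℕ}

/-- `f` is a 231-avoiding bijection of the position block `[p, p+m)` onto the value block
`[v, v+m)`, extended by the identity outside. [folklore] -/
def IsAvOn (p v m : ℕ) (f : Fin N → Fin N) : Prop :=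
  (∀ x : Fin N, ¬ (p ≤ (x : ℕ) ∧ (x : ℕ) < p + m) → f x = x) ∧
  (∀ x : Fin N, p ≤ (x : ℕ) → (x : ℕ) < p + m → v ≤ (f x : ℕ) ∧ (f x : ℕ) < v + m) ∧
  (∀ x y : Fin N, p ≤ (x : ℕ) → (x : ℕ) < p + m → p ≤ (y : ℕ) → (y : ℕ) < p + m →
    f x = f y → x = y) ∧
  (∀ x y z : Fin N, p ≤ (x : ℕ) → (z : ℕ) < p + m → x < y → y < z → f z < f x → f x < f y → False)

variable (k) in
/-- The weight `∏_{x ∈ [p, p+m)} x_{x, f x}` of a block bijection. [folklore] -/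
def awt (p m : ℕ) (f : Fin N → Fin N) : MvPolynomial (Fin N × Fin N) k :=
  ∏ x : Fin N, if p ≤ (x : ℕ) ∧ (x : ℕ) < p + m then X (x, f x) else 1

/-- Gluing: value `t` at position `q`, `f₁` left of `q`, `f₂` right of `q`. [folklore] -/
def aglue (q t : Fin N) (f₁ f₂ : Fin N → Fin N) : Fin N → Fin N :=
  fun x => if x = q then t else if (x : ℕ) < (q : ℕ) then f₁ x else f₂ x

/-! ### Counting tool -/

/-- The values of `f` on naturals (identity beyond `N`). [folklore] -/
def fv (f : Fin N → Fin N) (x : ℕ) : ℕ := if h : x < N then f ⟨x, h⟩ else x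

/-- `fv` in range. [folklore] -/
theorem fv_of_lt (f : Fin N → Fin N) {x : ℕ} (h : x < N) : fv f x = f ⟨x, h⟩ := by
  simp [fv, h]

/-- **Counting:** if `f` maps a set of positions injectively into a set of values, the former is
not larger. [folklore] -/
theorem card_le_of_fv {f : Fin N → Fin N} {s t : Finset ℕ} (hsN : ∀ x ∈ s, x < N)
    (hmaps : ∀ x (hx : x ∈ s), ((f ⟨x, hsN x hx⟩ : Fin N) : ℕ) ∈ t)
    (hinj : ∀ x (hx : x ∈ s) y (hy : y ∈ s), f ⟨x, hsN x hx⟩ = f ⟨y, hsN y hy⟩ → x = y) :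
    s.card ≤ t.card := by
  refine Finset.card_le_card_of_injOn (fv f) ?_ ?_
  · intro x hx
    have hx' : x ∈ s := by simpa using hx
    have := hmaps x hx'
    rw [← fv_of_lt f (hsN x hx')] at this
    simpa using this
  · intro x hx y hy hxy
    have hx' : x ∈ s := by simpa using hx
    have hy' : y ∈ s := by simpa using hy
    rw [fv_of_lt f (hsN x hx'), fv_of_lt f (hsN y hy')] at hxy
    exact hinj x hx' y hy' (Fin.ext hxy)

/-! ### Splitting at the maximum -/

section Split

variable {p v m : ℕ} {f : Fin N → Fin N}

/-- Every other block value lies strictly below the maximum. [folklore] -/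
theorem lt_top (hf : IsAvOn p v m f) {q : Fin N} (hq1 : p ≤ (q : ℕ)) (hq2 : (q : ℕ) < p + m)
    (hq3 : (f q : ℕ) = v + m - 1) (x : Fin N) (hx1 : p ≤ (x : ℕ)) (hx2 : (x : ℕ) < p + m)
    (hxq : x ≠ q) : (f x : ℕ) < v + m - 1 := by
  have h1 := (hf.2.1 x hx1 hx2).2
  have h2 : f x ≠ f q := fun h => hxq (hf.2.2.1 x q hx1 hx2 hq1 hq2 h)
  have h3 : (f x : ℕ) ≠ v + m - 1 := fun h => h2 (Fin.ext (by rw [h, hq3]))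
  omega

/-- **The maximum is attained** on the block (pigeonhole). [folklore] -/
theorem exists_top (hf : IsAvOn p v m f) (hm : 0 < m) (hpm : p + m ≤ N) :
    ∃ q : Fin N, p ≤ (q : ℕ) ∧ (q : ℕ) < p + m ∧ (f q : ℕ) = v + m - 1 := by
  by_contra h
  simp only [not_exists, not_and] at h
  have hc := card_le_of_fv (f := f) (s := Finset.Ico p (p + m)) (t := Finset.Ico v (v + m - 1))
    (fun x hx => by rw [Finset.mem_Ico] at hx; omega)
    (fun x hx => by
      rw [Finset.mem_Ico] at hx ⊢
      have h1 := hf.2.1 ⟨x, by omega⟩ hx.1 hx.2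
      have h2 := h ⟨x, by omega⟩ hx.1 hx.2
      omega)
    (fun x hx y hy hxy => by
      rw [Finset.mem_Ico] at hx hy
      have := hf.2.2.1 ⟨x, by omega⟩ ⟨y, by omega⟩ hx.1 hx.2 hy.1 hy.2 hxy
      simpa using congrArg Fin.val this)
  simp only [Nat.card_Ico] at hc
  omega

/-- **231-freeness across the maximum:** values left of the maximum lie below values right of
it. [folklore] -/
theorem lt_across (hf : IsAvOn p v m f) {q : Fin N} (hq1 : p ≤ (q : ℕ)) (hq2 : (q : ℕ) < p + m)
    (hq3 : (f q : ℕ) = v + m - 1) (a c : Fin N) (ha1 : p ≤ (a : ℕ)) (hac : a < q) (hqc : q < c)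
    (hc2 : (c : ℕ) < p + m) : (f a : ℕ) < (f c : ℕ) := by
  have hac' : (a : ℕ) < (q : ℕ) := hac
  have hqc' : (q : ℕ) < (c : ℕ) := hqc
  have hfa : (f a : ℕ) < v + m - 1 :=
    lt_top hf hq1 hq2 hq3 a ha1 (by omega) (fun h => by rw [h] at hac'; omega)
  have hlt : f a < f q := Fin.lt_def.mpr (by omega)
  have h231 := hf.2.2.2 a q c ha1 hc2 hac hqc
  have hne : f a ≠ f c := fun h => by
    have := hf.2.2.1 a c ha1 (by omega) (by omega) hc2 h
    rw [this] at hac'; omega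
  by_contra hn
  have hca : f c < f a := Fin.lt_def.mpr (by
    have : (f c : ℕ) ≠ (f a : ℕ) := fun h => hne (Fin.ext h.symm)
    omega)
  exact h231 hca hlt

/-- **Counting, left:** the values left of the maximum at `q` lie below `v + (q - p)`. [folklore] -/
theorem left_lt (hf : IsAvOn p v m f) {q : Fin N} (hq1 : p ≤ (q : ℕ)) (hq2 : (q : ℕ) < p + m)
    (hq3 : (f q : ℕ) = v + m - 1) (hpm : p + m ≤ N) (a : Fin N) (ha1 : p ≤ (a : ℕ)) (hac : a < q) :
    (f a : ℕ) < v + ((q : ℕ) - p) := by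
  have hac' : (a : ℕ) < (q : ℕ) := hac
  have hfa : (f a : ℕ) < v + m - 1 :=
    lt_top hf hq1 hq2 hq3 a ha1 (by omega) (fun h => by rw [h] at hac'; omega)
  have hc := card_le_of_fv (f := f) (s := Finset.Ioo (q : ℕ) (p + m))
    (t := Finset.Ioo (f a : ℕ) (v + m - 1))
    (fun x hx => by rw [Finset.mem_Ioo] at hx; omega)
    (fun x hx => by
      rw [Finset.mem_Ioo] at hx ⊢
      refine ⟨lt_across hf hq1 hq2 hq3 a ⟨x, by omega⟩ ha1 hac (Fin.lt_def.mpr hx.1) hx.2, ?_⟩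
      exact lt_top hf hq1 hq2 hq3 ⟨x, by omega⟩ (by simp only; omega) hx.2
        (fun h => by rw [← h] at hx; simp at hx))
    (fun x hx y hy hxy => by
      rw [Finset.mem_Ioo] at hx hy
      have := hf.2.2.1 ⟨x, by omega⟩ ⟨y, by omega⟩ (by simp only; omega) hx.2
        (by simp only; omega) hy.2 hxy
      simpa using congrArg Fin.val this)
  simp only [Nat.card_Ioo] at hc
  omega

/-- **Counting, right:** the values right of the maximum at `q` are at least `v + (q - p)`.
[folklore] -/
theorem right_ge (hf : IsAvOn p v m f) {q : Fin N} (hq1 : p ≤ (q : ℕ)) (hq2 : (q : ℕ) < p + m)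
    (hq3 : (f q : ℕ) = v + m - 1) (c : Fin N) (hqc : q < c)
    (hc2 : (c : ℕ) < p + m) : v + ((q : ℕ) - p) ≤ (f c : ℕ) := by
  have hqc' : (q : ℕ) < (c : ℕ) := hqc
  have hc := card_le_of_fv (f := f) (s := Finset.Ico p (q : ℕ)) (t := Finset.Ico v (f c : ℕ))
    (fun x hx => by rw [Finset.mem_Ico] at hx; omega)
    (fun x hx => by
      rw [Finset.mem_Ico] at hx ⊢
      exact ⟨(hf.2.1 ⟨x, by omega⟩ hx.1 (by simp only; omega)).1,
        lt_across hf hq1 hq2 hq3 ⟨x, by omega⟩ c hx.1 (Fin.lt_def.mpr hx.2) hqc hc2⟩)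
    (fun x hx y hy hxy => by
      rw [Finset.mem_Ico] at hx hy
      have := hf.2.2.1 ⟨x, by omega⟩ ⟨y, by omega⟩ hx.1 (by simp only; omega) hy.1
        (by simp only; omega) hxy
      simpa using congrArg Fin.val this)
  simp only [Nat.card_Ico] at hc
  have hvc := (hf.2.1 c (by omega) hc2).1
  omega

variable {a : ℕ}

/-- The restriction left of the maximum (at `p + a`) is a 231-avoiding bijection
`[p, p+a) → [v, v+a)`. [folklore] -/
theorem isAvOn_restrict_left (hf : IsAvOn p v m f) (ha : a < m) (hpm : p + m ≤ N)
    (htop : (f ⟨p + a, by omega⟩ : ℕ) = v + m - 1) : IsAvOn p v a (restrict p (p + a) f) := by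
  set q : Fin N := ⟨p + a, by omega⟩ with hq
  have hq1 : p ≤ (q : ℕ) := by simp [hq]
  have hq2 : (q : ℕ) < p + m := by simp [hq]; omega
  refine ⟨fun x hx => ?_, fun x hx1 hx2 => ?_, fun x y hx1 hx2 hy1 hy2 hxy => ?_,
    fun x y z hx hz hxy hyz h1 h2 => ?_⟩
  · simp only [restrict]; rw [if_neg hx]
  · have hx : restrict p (p + a) f x = f x := by simp only [restrict]; rw [if_pos ⟨hx1, hx2⟩]
    rw [hx]
    refine ⟨(hf.2.1 x hx1 (by omega)).1, ?_⟩
    have := left_lt hf hq1 hq2 htop hpm x hx1 (Fin.lt_def.mpr (by simp [hq]; omega))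
    simpa [hq] using this
  · have hx : restrict p (p + a) f x = f x := by simp only [restrict]; rw [if_pos ⟨hx1, hx2⟩]
    have hy : restrict p (p + a) f y = f y := by simp only [restrict]; rw [if_pos ⟨hy1, hy2⟩]
    rw [hx, hy] at hxy
    exact hf.2.2.1 x y hx1 (by omega) hy1 (by omega) hxy
  · have hxy' : (x : ℕ) < (y : ℕ) := hxy
    have hyz' : (y : ℕ) < (z : ℕ) := hyz
    have ex : restrict p (p + a) f x = f x := by
      simp only [restrict]; rw [if_pos ⟨hx, by omega⟩]
    have ey : restrict p (p + a) f y = f y := by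
      simp only [restrict]; rw [if_pos ⟨by omega, by omega⟩]
    have ez : restrict p (p + a) f z = f z := by
      simp only [restrict]; rw [if_pos ⟨by omega, hz⟩]
    rw [ex, ez] at h1
    rw [ex, ey] at h2
    exact hf.2.2.2 x y z hx (by omega) hxy hyz h1 h2

/-- The restriction right of the maximum (at `p + a`) is a 231-avoiding bijection
`(p+a, p+m) → [v+a, v+m-1)`. [folklore] -/
theorem isAvOn_restrict_right (hf : IsAvOn p v m f) (ha : a < m) (hpm : p + m ≤ N)
    (htop : (f ⟨p + a, by omega⟩ : ℕ) = v + m - 1) :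
    IsAvOn (p + a + 1) (v + a) (m - 1 - a) (restrict (p + a + 1) (p + m) f) := by
  set q : Fin N := ⟨p + a, by omega⟩ with hq
  have hq1 : p ≤ (q : ℕ) := by simp [hq]
  have hq2 : (q : ℕ) < p + m := by simp [hq]; omega
  refine ⟨fun x hx => ?_, fun x hx1 hx2 => ?_, fun x y hx1 hx2 hy1 hy2 hxy => ?_,
    fun x y z hx hz hxy hyz h1 h2 => ?_⟩
  · simp only [restrict]; rw [if_neg (by omega)]
  · have hx : restrict (p + a + 1) (p + m) f x = f x := by
      simp only [restrict]; rw [if_pos ⟨hx1, by omega⟩]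
    rw [hx]
    have hne : x ≠ q := fun h => by rw [h, hq] at hx1; simp at hx1
    refine ⟨?_, by have := lt_top hf hq1 hq2 htop x (by omega) (by omega) hne; omega⟩
    have := right_ge hf hq1 hq2 htop x (Fin.lt_def.mpr (by simp [hq]; omega)) (by omega)
    simpa [hq] using this
  · have hx : restrict (p + a + 1) (p + m) f x = f x := by
      simp only [restrict]; rw [if_pos ⟨hx1, by omega⟩]
    have hy : restrict (p + a + 1) (p + m) f y = f y := by
      simp only [restrict]; rw [if_pos ⟨hy1, by omega⟩]
    rw [hx, hy] at hxy
    exact hf.2.2.1 x y (by omega) (by omega) (by omega) (by omega) hxy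
  · have hxy' : (x : ℕ) < (y : ℕ) := hxy
    have hyz' : (y : ℕ) < (z : ℕ) := hyz
    have ex : restrict (p + a + 1) (p + m) f x = f x := by
      simp only [restrict]; rw [if_pos ⟨hx, by omega⟩]
    have ey : restrict (p + a + 1) (p + m) f y = f y := by
      simp only [restrict]; rw [if_pos ⟨by omega, by omega⟩]
    have ez : restrict (p + a + 1) (p + m) f z = f z := by
      simp only [restrict]; rw [if_pos ⟨by omega, by omega⟩]
    rw [ex, ez] at h1
    rw [ex, ey] at h2
    exact hf.2.2.2 x y z (by omega) (by omega) hxy hyz h1 h2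

/-- **Weight factorisation at the maximum:** `awt f = x_{q, f q} · awt f|left · awt f|right`.
[folklore] -/
theorem awt_eq_mul (ha : a < m) (hpm : p + m ≤ N) :
    awt k p m f = X (⟨p + a, by omega⟩, f ⟨p + a, by omega⟩) * awt k p a (restrict p (p + a) f) *
      awt k (p + a + 1) (m - 1 - a) (restrict (p + a + 1) (p + m) f) := by
  classical
  set q : Fin N := ⟨p + a, by omega⟩ with hq
  have key : ∀ x : Fin N,
      (if p ≤ (x : ℕ) ∧ (x : ℕ) < p + m then X (x, f x) else (1 : MvPolynomial (Fin N × Fin N) k)) =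
      (if x = q then X (q, f q) else 1) *
      (if p ≤ (x : ℕ) ∧ (x : ℕ) < p + a then X (x, restrict p (p + a) f x) else 1) *
      (if p + a + 1 ≤ (x : ℕ) ∧ (x : ℕ) < p + a + 1 + (m - 1 - a) then
        X (x, restrict (p + a + 1) (p + m) f x) else 1) := by
    intro x
    by_cases hxq : x = q
    · subst hxq
      simp [hq, show a < m from ha]
    · rw [if_neg hxq, one_mul]
      have hxq' : (x : ℕ) ≠ p + a := fun h => hxq (Fin.ext (by simp [hq, h]))
      by_cases hl : p ≤ (x : ℕ) ∧ (x : ℕ) < p + a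
      · have h1 : restrict p (p + a) f x = f x := by simp only [restrict]; rw [if_pos hl]
        rw [h1, if_pos hl, if_pos (show p ≤ (x : ℕ) ∧ (x : ℕ) < p + m by omega), if_neg (by omega),
          mul_one]
      · rw [if_neg hl, one_mul]
        by_cases hr : p + a + 1 ≤ (x : ℕ) ∧ (x : ℕ) < p + a + 1 + (m - 1 - a)
        · have h2 : restrict (p + a + 1) (p + m) f x = f x := by
            simp only [restrict]; rw [if_pos (by omega)]
          rw [h2, if_pos hr, if_pos (by omega)]
        · rw [if_neg hr, if_neg (by omega)]
  unfold awt
  rw [Finset.prod_congr rfl fun x _ => key x, Finset.prod_mul_distrib, Finset.prod_mul_distrib,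
    Finset.prod_ite_eq']
  simp

/-! ### Gluing -/

variable {f₁ f₂ : Fin N → Fin N} {q t : Fin N}

/-- Values of the glued map at the split position. [folklore] -/
theorem aglue_self : aglue q t f₁ f₂ q = t := by simp [aglue]

/-- Values of the glued map left of the split. [folklore] -/
theorem aglue_of_lt (x : Fin N) (hx : (x : ℕ) < (q : ℕ)) : aglue q t f₁ f₂ x = f₁ x := by
  have : x ≠ q := fun h => by rw [h] at hx; exact lt_irrefl _ hx
  simp [aglue, this, hx]

/-- Values of the glued map right of the split. [folklore] -/
theorem aglue_of_gt (x : Fin N) (hx : (q : ℕ) < (x : ℕ)) : aglue q t f₁ f₂ x = f₂ x := by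
  have h1 : x ≠ q := fun h => by rw [h] at hx; exact lt_irrefl _ hx
  have h2 : ¬ (x : ℕ) < (q : ℕ) := by omega
  simp [aglue, h1, h2]

/-- **Gluing two 231-avoiding block bijections under a new maximum gives one.** [folklore] -/
theorem isAvOn_aglue (ha : a < m) (hpm : p + m ≤ N) (hvm : v + m ≤ N) (h₁ : IsAvOn p v a f₁)
    (h₂ : IsAvOn (p + a + 1) (v + a) (m - 1 - a) f₂) :
    IsAvOn p v m (aglue ⟨p + a, by omega⟩ ⟨v + m - 1, by omega⟩ f₁ f₂) := by
  set q : Fin N := ⟨p + a, by omega⟩ with hq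
  set t : Fin N := ⟨v + m - 1, by omega⟩ with ht
  have gl := fun (x : Fin N) (h : (x : ℕ) < p + a) =>
    aglue_of_lt (q := q) (t := t) (f₁ := f₁) (f₂ := f₂) x (by simpa [hq] using h)
  have gr := fun (x : Fin N) (h : p + a < (x : ℕ)) =>
    aglue_of_gt (q := q) (t := t) (f₁ := f₁) (f₂ := f₂) x (by simpa [hq] using h)
  have gq : aglue q t f₁ f₂ q = t := aglue_self
  -- values by region
  have vl : ∀ x : Fin N, p ≤ (x : ℕ) → (x : ℕ) < p + a →
      v ≤ (aglue q t f₁ f₂ x : ℕ) ∧ (aglue q t f₁ f₂ x : ℕ) < v + a := fun x h1 h2 => by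
    rw [gl x h2]; exact h₁.2.1 x h1 h2
  have vr : ∀ x : Fin N, p + a < (x : ℕ) → (x : ℕ) < p + m →
      v + a ≤ (aglue q t f₁ f₂ x : ℕ) ∧ (aglue q t f₁ f₂ x : ℕ) < v + m - 1 := fun x h1 h2 => by
    rw [gr x h1]; have := h₂.2.1 x (by omega) (by omega); omega
  have vq : (aglue q t f₁ f₂ q : ℕ) = v + m - 1 := by rw [gq, ht]
  have eqq : ∀ x : Fin N, (x : ℕ) = p + a → x = q := fun x h => Fin.ext (by simp [hq, h])
  refine ⟨fun x hx => ?_, fun x hx1 hx2 => ?_, fun x y hx1 hx2 hy1 hy2 hxy => ?_,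
    fun x y z hx hz hxy hyz hzx hxy' => ?_⟩
  · -- identity outside the block
    by_cases h : (x : ℕ) < p + a
    · rw [gl x h]; exact h₁.1 x (by omega)
    · rw [gr x (by omega)]; exact h₂.1 x (by omega)
  · -- values in `[v, v+m)`
    rcases lt_trichotomy (x : ℕ) (p + a) with h | h | h
    · have := vl x hx1 h; omega
    · rw [eqq x h]; omega
    · have := vr x h hx2; omega
  · -- injective on the block
    have hv : (aglue q t f₁ f₂ x : ℕ) = (aglue q t f₁ f₂ y : ℕ) := by rw [hxy]
    rcases lt_trichotomy (x : ℕ) (p + a) with hx | hx | hx <;>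
      rcases lt_trichotomy (y : ℕ) (p + a) with hy | hy | hy
    · rw [gl x hx, gl y hy] at hxy; exact h₁.2.2.1 x y hx1 hx hy1 hy hxy
    · exfalso; have := vl x hx1 hx; rw [eqq y hy] at hv; omega
    · exfalso; have h1 := vl x hx1 hx; have h2 := vr y hy hy2; omega
    · exfalso; have := vl y hy1 hy; rw [eqq x hx] at hv; omega
    · exact (eqq x hx).trans (eqq y hy).symm
    · exfalso; have := vr y hy hy2; rw [eqq x hx] at hv; omega
    · exfalso; have h1 := vr x hx hx2; have h2 := vl y hy1 hy; omega
    · exfalso; have := vr x hx hx2; rw [eqq y hy] at hv; omega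
    · rw [gr x hx, gr y hy] at hxy
      exact h₂.2.2.1 x y (by omega) (by omega) (by omega) (by omega) hxy
  · -- no 231 pattern
    have hxy0 : (x : ℕ) < (y : ℕ) := hxy
    have hyz0 : (y : ℕ) < (z : ℕ) := hyz
    have hzx0 : (aglue q t f₁ f₂ z : ℕ) < (aglue q t f₁ f₂ x : ℕ) := hzx
    have hxy1 : (aglue q t f₁ f₂ x : ℕ) < (aglue q t f₁ f₂ y : ℕ) := hxy'
    rcases lt_trichotomy (z : ℕ) (p + a) with hz' | hz' | hz'
    · -- all three left of `q`
      rw [gl x (by omega), gl z hz'] at hzx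
      rw [gl x (by omega), gl y (by omega)] at hxy'
      exact h₁.2.2.2 x y z hx hz' hxy hyz hzx hxy'
    · rw [eqq z hz'] at hzx0; have := vl x hx (by omega); omega
    · rcases lt_trichotomy (x : ℕ) (p + a) with hx' | hx' | hx'
      · have h1 := vl x hx hx'; have h2 := vr z hz' hz; omega
      · rw [eqq x hx'] at hxy1
        have := vr y (by omega) (by omega); omega
      · rw [gr x hx', gr z hz'] at hzx
        rw [gr x hx', gr y (by omega)] at hxy'
        exact h₂.2.2.2 x y z (by omega) (by omega) hxy hyz hzx hxy'

/-- Restricting the glued map to the left recovers `f₁`. [folklore] -/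
theorem restrict_aglue_left (hq : (q : ℕ) = p + a) (h₁ : IsAvOn p v a f₁) :
    restrict p (p + a) (aglue q t f₁ f₂) = f₁ := by
  funext x
  simp only [restrict]
  split_ifs with h
  · exact aglue_of_lt x (by omega)
  · exact (h₁.1 x h).symm

/-- Restricting the glued map to the right recovers `f₂`. [folklore] -/
theorem restrict_aglue_right (hq : (q : ℕ) = p + a) (ha : a < m)
    (h₂ : IsAvOn (p + a + 1) (v + a) (m - 1 - a) f₂) :
    restrict (p + a + 1) (p + m) (aglue q t f₁ f₂) = f₂ := by
  funext x
  simp only [restrict]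
  split_ifs with h
  · exact aglue_of_gt x (by omega)
  · exact (h₂.1 x (by omega)).symm

/-- Gluing back the two restrictions recovers `f`. [folklore] -/
theorem aglue_restrict (hf : IsAvOn p v m f) :
    aglue q (f q) (restrict p (q : ℕ) f) (restrict ((q : ℕ) + 1) (p + m) f) = f := by
  funext x
  rcases lt_trichotomy (x : ℕ) (q : ℕ) with h | h | h
  · rw [aglue_of_lt x h]
    simp only [restrict]
    split_ifs with h'
    · rfl
    · exact (hf.1 x (by omega)).symm
  · rw [Fin.ext h, aglue_self]
  · rw [aglue_of_gt x h]
    simp only [restrict]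
    split_ifs with h'
    · rfl
    · exact (hf.1 x (by omega)).symm

end Split

end Summit.ValiantsHypothesis.ValiantsHypothesis.Theorems.FifoMatching

end
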